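import Summits.ResolutionOfSingularities.ResolutionOfSingularities.Theorems.EquisingularLiftEquisingularLiftNatTowerBPointSteps
import Summits.ResolutionOfSingularities.ResolutionOfSingularities.Theorems.EquisingularLiftEquisingularLiftNatPointPlaneModel
import HarnessLib

/-!
# [OURS · L1 W4.5(b) · EL♮(3) · T23-A‴ (F1)-BIRTH, TOWER LEVEL] THE ROUND-PHASE POINT PLANE IS BORN WITH ITS MODEL
# — `Tower.Exc₃`'s `∃ 𝓔` branch for the new plane of a `(pt-reg)` section step, and the stage step carrying the model

res-L1-w45b-stub-2 g13 (stub worker 2; desk res-L1-w45b-plan-1 g20 DEAL (A′) 2026-08-28T10:07:02Z: «tower-level packaging … the engine-word-INDEPENDENT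
value … DEALT TO YOU NOW»; engine word res-L1-w45b-stub-4 `T23AF-ENGINE-WORD.md` v0 095471eb3c14cc91 §1 (F1) / v1 DRAFT 3dcf936910c4d869 §3 (U2)). The LOCAL
clauses (e-i)–(e-v) of the plane model are res-L1-w45b-lead-1's `Sections.pointPlane_model` (…NatPointPlaneModel, p623734) — IMPORTED, not restated.
Crux EL♮(3) = stmt-ResolutionOfSingularities-20148 (parent EL♮ stmt-…-20038; bookkeeping node stmt-…-15660), route `EquisingularLift`, line `sections`.
OURS; NOT a statement of any manuscript ([Hironaka2017] is a candidate under adjudication, nothing of it is asserted); AI-written, weaker than expert review.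
DEF-FREE; no `sorry`; standard axioms. `--supports stmt-ResolutionOfSingularities-20148 --as helper`.

WHAT. In the B-towers (…NatTowerBPointSteps) the exceptional plane `E' = υ₂⁻¹{pt}` of a point step is born `Tower.NoRound` (first disjunct of `Tower.Exc₃`):
it carries NO upstairs model, so it can host or witness no boundary («pair») round and `TowerFull` is needed to dismiss it. (F1): the plane of a `(pt-reg)` step
— realised upstairs by the blow-up `τ : X'' → X` of the kernel of a SECTION `s : Spec O → X` through `jG pt` (`modelPointStep` + `modelPointStep_of_section`) —
is BORN WITH the model `𝓔 := (ker s)·𝒪_{X''}` (the exceptional divisor `E_C ≅ ℙ²_O` of `Bl_C X`, `C = V(ker s) ≅ Spec O`).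
* `exists_planeModel` — lead-1's five local clauses for `𝓔 := (ker s)·𝒪_{X''}` repackaged in the engine's letters: (e-i) for EVERY closedness witness of
  `υ₂⁻¹{pt}` (the `∀ hE` binder of `Tower.Exc₃`), (e-iv) at `N := {¬ IsGenericPoint · Y}`, `FE` bracketed as `(τ ≫ σ) ≫ q`, plus `IsEffectiveCartier 𝓔`;
* `Tower.exc₃_newPlane_of_section` — **the new plane satisfies the `∃ 𝓔` BRANCH of `Tower.Exc₃`** (shadow forgotten) for ANY ruled datum holding at `𝓔`
  (`hRuledBirth`); `_FE` twin at the engine's datum «`V(𝓔)` is `O`-flat» with `hRuledBirth` discharged — the type-level check that the block is in `Exc₃`/`Exc₄` currency;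
* `Tower.exists_ptReg_stage_planeModel` — **the `(pt-reg)` stage step WITH the plane model**: from the unpacked upstairs stage at `G` and the `TowerPtRegB`
  hypotheses, the new stage `(s, X'', τ, j₂, t₂)` with EVERY output `Tower.invB_pointStep` consumes today (`hτ`, `hdisj`, `hcomm`, `hCh''`, regular, dominant,
  `hsq₂`, `hsets`, irreducible, …) AND the six plane-model clauses — so the engine owner's (U2)′ re-cut `Tower.towerPtRegB₄_invB₄` over his (U1) `Exc₄`/`InvB₄`
  is `obtain …; exact …`. The same package serves (U6) (in-carrier planes at a section step inside the carrier).
NOT covered (engine word v1 §1 (n1) agrees): the `(pt-ram)` FAT plane — ramified multisection centre, special fibre of `E_C` not reduced, no model of this shape.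
[cite: Liu2002, §8.1 and Thm. 8.1.19 (b)] [cite: GortzWedhorn2020, Prop. 13.91 (3) and (13.19)] (method; index only).
-/

set_option linter.dupNamespace false -- mandated namespace `Summit.<Summit>.<Problem>` of this single-conjunct summit
set_option linter.overlappingInstances false -- the binders carry `[IsDomain O] [IsDiscreteValuationRing O]`

noncomputable section

open CategoryTheory CategoryTheory.Limits AlgebraicGeometry TopologicalSpace Topology IsLocalRing
open Literature.AlgebraicGeometry.Resolution
open AlgebraicGeometry.Scheme.IdealSheafData
open Summit.ResolutionOfSingularities.ResolutionOfSingularities.Theses.EquisingularLift.Split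
open Summit.ResolutionOfSingularities.ResolutionOfSingularities.Cruxes.EquisingularLift.StrataSplit

namespace Summit.ResolutionOfSingularities.ResolutionOfSingularities.Cruxes.EquisingularLiftNat.Sections

/-! ## The plane-model package at an explicit section step (engine letters; over lead-1's `pointPlane_model`) -/

section PlaneModel

variable {O : Type} [CommRing O] {P : Scheme.{0}} {q : P ⟶ Spec (.of O)} {Y : Set P}
  {X X'' G G' : Scheme.{0}} {σ : X ⟶ P} {jG : G ⟶ X} {s : Spec (.of O) ⟶ X} {τ : X'' ⟶ X}

/-- **THE PLANE-MODEL PACKAGE at an explicit section step** (res-L1-w45b-lead-1's `pointPlane_model` in the engine's letters): `𝓔 := (ker s)·𝒪_{X''}` with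
(e-i) reduced trace `𝓘⟨υ₂⁻¹{pt}⟩` for EVERY closedness witness (the `∀ hE` binder of `Tower.Exc₃`), (e-ii) principal stalks, (e-iii) regular zero locus,
(e-iv) off the generic point of `Y`, `FE` flat over `O` (bracketed `(τ ≫ σ) ≫ q`), and effective Cartier. [cite: Liu2002, Thm. 8.1.19 (b)]
[OURS · L1 W4.5b · T23-A‴ (F1)-birth]; NOT a statement of the manuscript. -/
theorem exists_planeModel [IsLocallyNoetherian X] [IsLocallyNoetherian G] (hXreg : Scheme.IsRegular X)
    (hsreg : Scheme.IsRegular s.ker.subscheme) (hsflat : Flat (s.ker.subschemeι ≫ σ ≫ q))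
    (hsoff : ∀ c ∈ (s.ker.support : Set X), ¬ IsGenericPoint (σ c) Y) (hτ : IsBlowup τ s.ker)
    {pt : G} (hyc : IsClosed ({pt} : Set G)) (hGreg : IsRegularLocalRing (G.presheaf.stalk pt))
    {υ₂ : G' ⟶ G} (hυ₂ : IsBlowup υ₂ (vanishingIdeal ⟨{pt}, hyc⟩))
    {j₂ : G' ⟶ X''} (hcomm : j₂ ≫ τ = υ₂ ≫ jG) (hCD : s.ker.comap jG = vanishingIdeal ⟨{pt}, hyc⟩) :
    ∃ 𝓔 : X''.IdealSheafData, 𝓔 = s.ker.comap τ ∧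
      (∀ hE : IsClosed (υ₂ ⁻¹' ({pt} : Set G)), 𝓔.comap j₂ = vanishingIdeal (⟨υ₂ ⁻¹' {pt}, hE⟩ : Closeds G')) ∧
      (∀ z : X'', (stalkIdeal 𝓔 z).IsPrincipal) ∧ Scheme.IsRegular 𝓔.subscheme ∧
      (τ ≫ σ) '' (𝓔.support : Set X'') ⊆ {p : P | ¬ IsGenericPoint p Y} ∧
      Flat (𝓔.subschemeι ≫ (τ ≫ σ) ≫ q) ∧ IsEffectiveCartier 𝓔 := by
  have hoff : σ '' (s.ker.support : Set X) ⊆ {p : P | ¬ IsGenericPoint p Y} := by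
    rintro _ ⟨c, hc, rfl⟩
    exact hsoff c hc
  obtain ⟨h1, h2, h3, h4, h5⟩ :=
    pointPlane_model hXreg (σ ≫ q) σ {p : P | ¬ IsGenericPoint p Y} s.ker hsreg hsflat hoff hτ hcomm hyc hGreg hυ₂ hCD
  exact ⟨s.ker.comap τ, rfl, fun _ => h1, h2, h3, h4, by simpa only [Category.assoc] using h5, hτ.isEffectiveCartier⟩

end PlaneModel

/-! ## The plane model in the currency of `Tower.Exc₃` (type-level check of the block) -/

section ExcBranch

variable (O : Type) [CommRing O] (P : Scheme.{0}) (q : P ⟶ Spec (.of O)) (Y : Set P) (Ruled : Tower.RuledDatum P)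
  {F₉ : Scheme.{0}} {Z₉ : Set F₉} {hZ₉ : IsClosed Z₉} {F₁₀ : Scheme.{0}} {υ' : F₁₀ ⟶ F₉}
  {X X'' G G' : Scheme.{0}} {σ : X ⟶ P} {jG : G ⟶ X} {γ : G ⟶ F₁₀} {s : Spec (.of O) ⟶ X} {τ : X'' ⟶ X}

/-- **The new plane `υ₂⁻¹{pt}` of a `(pt-reg)` section step satisfies the `∃ 𝓔` BRANCH of `Tower.Exc₃`** (shadow forgotten, `K := ∅`) for ANY
ruled-surface datum holding at `𝓔 := (ker s)·𝒪_{X''}` (`hRuledBirth`) — instead of the `Tower.NoRound` branch it is born with today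
(`Tower.noRound_pointCentre_new`). [cite: Liu2002, Thm. 8.1.19 (b)] [OURS · L1 W4.5b · T23-A‴ (F1)-birth]; NOT a statement of the manuscript. -/
theorem Tower.exc₃_newPlane_of_section [IsLocallyNoetherian X] [IsLocallyNoetherian G] (hXreg : Scheme.IsRegular X)
    (hsreg : Scheme.IsRegular s.ker.subscheme) (hsflat : Flat (s.ker.subschemeι ≫ σ ≫ q))
    (hsoff : ∀ c ∈ (s.ker.support : Set X), ¬ IsGenericPoint (σ c) Y) (hτ : IsBlowup τ s.ker)
    {pt : G} (hyc : IsClosed ({pt} : Set G)) (hGreg : IsRegularLocalRing (G.presheaf.stalk pt))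
    {υ₂ : G' ⟶ G} (hυ₂ : IsBlowup υ₂ (vanishingIdeal ⟨{pt}, hyc⟩))
    {j₂ : G' ⟶ X''} (hcomm : j₂ ≫ τ = υ₂ ≫ jG) (hCD : s.ker.comap jG = vanishingIdeal ⟨{pt}, hyc⟩)
    (hRuledBirth : Ruled F₉ Z₉ hZ₉ F₁₀ υ' G' (υ₂ ≫ γ) (υ₂ ⁻¹' {pt}) X'' (τ ≫ σ) j₂ (s.ker.comap τ))
    (hE : IsClosed (υ₂ ⁻¹' ({pt} : Set G))) :
    Tower.Exc₃ O P q Y Ruled Z₉ hZ₉ υ' G' (υ₂ ≫ γ) (υ₂ ⁻¹' {pt}) hE ∅ X'' (τ ≫ σ) j₂ := by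
  obtain ⟨𝓔, rfl, h1, h2, h3, h4, -, -⟩ := exists_planeModel (Y := Y) hXreg hsreg hsflat hsoff hτ hyc hGreg hυ₂ hcomm hCD
  exact Or.inr ⟨s.ker.comap τ, h1 hE, h2, h3, h4, hRuledBirth, Or.inl rfl⟩

/-- **The same at the engine's datum `FE := «V(𝓔) is O-flat»`** (…NatTowerBPointStepsFE): `hRuledBirth` discharged by the `FE` clause of the package.
[cite: Liu2002, Thm. 8.1.19 (b)] [OURS · L1 W4.5b · T23-A‴ (F1)-birth]; NOT a statement of the manuscript. -/
theorem Tower.exc₃_newPlane_of_section_FE [IsLocallyNoetherian X] [IsLocallyNoetherian G] (hXreg : Scheme.IsRegular X)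
    (hsreg : Scheme.IsRegular s.ker.subscheme) (hsflat : Flat (s.ker.subschemeι ≫ σ ≫ q))
    (hsoff : ∀ c ∈ (s.ker.support : Set X), ¬ IsGenericPoint (σ c) Y) (hτ : IsBlowup τ s.ker)
    {pt : G} (hyc : IsClosed ({pt} : Set G)) (hGreg : IsRegularLocalRing (G.presheaf.stalk pt))
    {υ₂ : G' ⟶ G} (hυ₂ : IsBlowup υ₂ (vanishingIdeal ⟨{pt}, hyc⟩))
    {j₂ : G' ⟶ X''} (hcomm : j₂ ≫ τ = υ₂ ≫ jG) (hCD : s.ker.comap jG = vanishingIdeal ⟨{pt}, hyc⟩)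
    (hE : IsClosed (υ₂ ⁻¹' ({pt} : Set G))) :
    Tower.Exc₃ O P q Y (fun _ _ _ _ _ _ _ _ _ σ₀ _ 𝓔 => Flat (𝓔.subschemeι ≫ σ₀ ≫ q)) Z₉ hZ₉ υ' G' (υ₂ ≫ γ) (υ₂ ⁻¹' {pt}) hE ∅
      X'' (τ ≫ σ) j₂ := by
  obtain ⟨𝓔, rfl, -, -, -, -, h5, -⟩ := exists_planeModel (Y := Y) hXreg hsreg hsflat hsoff hτ hyc hGreg hυ₂ hcomm hCD
  exact Tower.exc₃_newPlane_of_section O P q Y _ hXreg hsreg hsflat hsoff hτ hyc hGreg hυ₂ hcomm hCD h5 hE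

end ExcBranch

/-! ## The `(pt-reg)` stage step with the plane model -/

section PtRegStage

variable (O : Type) [CommRing O] [IsDomain O] [IsDiscreteValuationRing O] [IsAdicComplete (maximalIdeal O) O]
  [IsAlgClosed (ResidueField O)] (k : Type) [Field k] (θ : O →+* k) (hθ : Function.Surjective θ)
  (P : Scheme.{0}) (q : P ⟶ Spec (.of O)) (Y : Set P) (hYsp : Y ⊆ q ⁻¹' {closedPoint O}) (hYirr : IsIrreducible Y)
  (hYcl : IsClosed Y) [IsProper q] (hPnoeth : IsLocallyNoetherian P) (hPreg : Scheme.IsRegular P)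
  (Ch : ∀ X' : Scheme.{0}, (X' ⟶ P) → Set X' → Prop)
  (hChain : ∀ (X' : Scheme.{0}) (σ : X' ⟶ P) (S : Set X'), Ch X' σ S → Chain P Y X' σ S)
  (hStep : ∀ (X' X'' : Scheme.{0}) (σ' : X' ⟶ P) (S' : Set X') (C : X'.IdealSheafData) (τ : X'' ⟶ X'),
    Ch X' σ' S' → IsBlowup τ C → Scheme.IsRegular C.subscheme → Flat (C.subschemeι ≫ σ' ≫ q) →
    σ' '' (C.support : Set X') ⊆ {x : P | ¬ IsGenericPoint x Y} →
    (C.support : Set X') ∩ (σ' ≫ q) ⁻¹' {closedPoint O} ⊆ S' →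
    Ch X'' (τ ≫ σ') (closure (τ ⁻¹' (S' \ (C.support : Set X')))))

include hθ hYsp hYirr hYcl hPnoeth hPreg hChain hStep

/-- **THE `(pt-reg)` STAGE STEP WITH THE PLANE MODEL.** From an upstairs `Ch`-stage `(X, σ, S)` (integral, regular, locally Noetherian, dominant over
`Spec O`) in a model square `jG : G → X` over `θ` with `jG '' T = S`, a closed point `pt ∈ T`, `T ⊄ {pt}`, with `𝒪_{G,pt}` REGULAR, and the downstairs
blow-up `υ₂ : G' → G` of the reduced point: a section `s` through `jG pt` (Hensel, `modelPointStep`), the blow-up `τ : X'' → X` of `ker s`, the new model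
square `j₂ : G' → X''` (`modelPointStep_of_section`) with EVERY output the B-point-step core `Tower.invB_pointStep` consumes — AND the plane model
`𝓔 := (ker s)·𝒪_{X''}` of the new plane `υ₂⁻¹{pt}` with (e-i)–(e-iv), `FE`, Cartier (`exists_planeModel`). [cite: Liu2002, §8.1 and Thm. 8.1.19]
[cite: GortzWedhorn2020, Prop. 13.91 (3) and (13.19)] [OURS · L1 W4.5b · T23-A‴ (F1)-birth] toward the engine owner's `Exc₄`/`InvB₄` re-cut of
`TowerPtRegB`; NOT a statement of the manuscript. -/
theorem Tower.exists_ptReg_stage_planeModel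
    (X : Scheme.{0}) (σ : X ⟶ P) (S : Set X) (hCh : Ch X σ S) [IsIntegral X] [IsLocallyNoetherian X] (hXreg : Scheme.IsRegular X)
    (hdom : IsDominant (σ ≫ q)) (G : Scheme.{0}) [IsIntegral G] (jG : G ⟶ X) (tG : G ⟶ Spec (.of k))
    (hsq : IsPullback jG tG (σ ≫ q) (Spec.map (CommRingCat.ofHom θ))) (T : Set G) (hTS : jG '' T = S)
    (pt : G) (hyc : IsClosed ({pt} : Set G)) (hyT : pt ∈ T) (hTy : ¬ T ⊆ {pt}) (hGreg : IsRegularLocalRing (G.presheaf.stalk pt))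
    (G' : Scheme.{0}) (υ₂ : G' ⟶ G) (hυ₂ : IsBlowup υ₂ (vanishingIdeal ⟨{pt}, hyc⟩)) :
    ∃ (s : Spec (.of O) ⟶ X) (X'' : Scheme.{0}) (τ : X'' ⟶ X) (j₂ : G' ⟶ X'') (t₂ : G' ⟶ Spec (.of k)),
      -- the section and the upstairs centre
      s ≫ σ ≫ q = 𝟙 _ ∧ s (closedPoint O) = jG pt ∧ IsBlowup τ s.ker ∧
      Scheme.IsRegular s.ker.subscheme ∧ Flat (s.ker.subschemeι ≫ σ ≫ q) ∧ s.ker.comap jG = vanishingIdeal ⟨{pt}, hyc⟩ ∧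
      (∀ c ∈ (s.ker.support : Set X), ¬ IsGenericPoint (σ c) Y) ∧
      (s.ker.support : Set X) ∩ (σ ≫ q) ⁻¹' {closedPoint O} = {jG pt} ∧
      (∀ I : X.IdealSheafData, jG pt ∉ (I.support : Set X) → Disjoint (I.support : Set X) (s.ker.support : Set X)) ∧
      -- the new stage
      Ch X'' (τ ≫ σ) (j₂ '' closure (υ₂ ⁻¹' (T \ {pt}))) ∧ Scheme.IsRegular X'' ∧ IsLocallyNoetherian X'' ∧ IsIntegral X'' ∧
      IsDominant ((τ ≫ σ) ≫ q) ∧ IsIntegral G' ∧ IsIrreducible (closure (υ₂ ⁻¹' (T \ {pt}))) ∧ IsLocallyNoetherian G ∧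
      -- the new model square
      IsPullback j₂ t₂ ((τ ≫ σ) ≫ q) (Spec.map (CommRingCat.ofHom θ)) ∧ j₂ ≫ τ = υ₂ ≫ jG ∧
      (s.ker.comap τ).comap j₂ = (vanishingIdeal ⟨{pt}, hyc⟩ : G.IdealSheafData).comap υ₂ ∧
      j₂ '' closure (υ₂ ⁻¹' (T \ {pt})) = closure (τ ⁻¹' (S \ (s.ker.support : Set X))) ∧
      -- THE PLANE MODEL `𝓔 := (ker s)·𝒪_{X''}` of the new plane `υ₂⁻¹{pt}`
      (∀ hE : IsClosed (υ₂ ⁻¹' ({pt} : Set G)), (s.ker.comap τ).comap j₂ = vanishingIdeal (⟨υ₂ ⁻¹' {pt}, hE⟩ : Closeds G')) ∧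
      (∀ z : X'', (stalkIdeal (s.ker.comap τ) z).IsPrincipal) ∧ Scheme.IsRegular (s.ker.comap τ).subscheme ∧
      (τ ≫ σ) '' ((s.ker.comap τ).support : Set X'') ⊆ {p : P | ¬ IsGenericPoint p Y} ∧
      Flat ((s.ker.comap τ).subschemeι ≫ (τ ≫ σ) ≫ q) ∧ IsEffectiveCartier (s.ker.comap τ) := by
  classical
  -- adapted from `Tower.towerPtRegB_invB` (…NatTowerBPointSteps, res-L1-w45b-stub-4): same section, same blow-ups, plus `exists_planeModel`
  haveI := hdom
  obtain ⟨-, -, hσ⟩ := chain_isRegular P Y X σ S (hChain _ _ _ hCh) hPnoeth hPreg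
  haveI := hσ
  haveI hproper : IsProper (σ ≫ q) := inferInstance
  haveI : IsClosedImmersion (Spec.map (CommRingCat.ofHom θ)) := IsClosedImmersion.spec_of_surjective _ hθ
  haveI hjci : IsClosedImmersion jG := MorphismProperty.IsStableUnderBaseChange.of_isPullback hsq.flip inferInstance
  have hjyc : IsClosed ({jG pt} : Set X) := by
    simpa only [Set.image_singleton] using hjci.isClosedEmbedding.isClosedMap _ hyc
  have hyoff : ¬ IsGenericPoint (σ (jG pt)) Y :=
    not_isGenericPoint_of_image_eq (hChain _ _ _ hCh) jG hjci.isClosedEmbedding.injective hTS hjyc hTy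
  have hjsp : (σ ≫ q) (jG pt) = closedPoint O := by
    have h1 : jG pt ∈ Set.range jG := ⟨_, rfl⟩
    rw [range_eq_preimage_of_isPullback hsq, range_specMap_of_surjective_of_field θ hθ] at h1
    exact h1
  haveI hGnoeth : IsLocallyNoetherian G := LocallyOfFiniteType.isLocallyNoetherian jG
  -- the section through `jG pt` and the blow-up of its kernel, then the model step with this section
  obtain ⟨-, s, X'', τ, -, -, -, hs, hss₀, -, hτ, -, -, hnoeth'', -⟩ :=
    modelPointStep O k θ hθ P q Y hYsp Ch hStep X σ S hCh hXreg hproper hdom G jG tG hsq T hTS pt hyc hGreg hyT hTy hyoff G' υ₂ hυ₂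
  haveI := hnoeth''
  obtain ⟨hCh'', hreg'', -, hint'', hdom'', hG'int, hT'irr, hCD, hsoff, hsreg, hsflat, j₂, t₂, hsq₂, hcomm, hcarrier, hsets⟩ :=
    modelPointStep_of_section O k θ hθ P q Y hYsp hYirr hYcl Ch hChain hStep X σ S hCh hXreg hdom G jG tG hsq T hTS pt hyc hyT hTy
      hyoff s hs hss₀ X'' τ hτ G' υ₂ hυ₂
  haveI := hint''
  haveI := hG'int
  -- the centre meets the special fibre in `jG pt` only
  obtain ⟨_, -, -, hCsupp⟩ := section_isClosedImmersion_and_isRegular_ker O X (σ ≫ q) s hs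
  have hCb : (s.ker.support : Set X) ∩ (σ ≫ q) ⁻¹' {closedPoint O} = {jG pt} := by
    ext z
    constructor
    · rintro ⟨hz, hzsp⟩
      rw [hCsupp] at hz
      obtain ⟨p, rfl⟩ := hz
      have hp : p = closedPoint O := by
        have h1 : (s ≫ σ ≫ q) p = p := by rw [hs]; rfl
        rw [Scheme.Hom.comp_apply] at h1
        rw [← h1]; exact hzsp
      rw [Set.mem_singleton_iff, hp, hss₀]
    · rintro rfl
      refine ⟨?_, hjsp⟩
      rw [hCsupp, ← hss₀]; exact ⟨_, rfl⟩
  have hdisj : ∀ I : X.IdealSheafData, jG pt ∉ (I.support : Set X) → Disjoint (I.support : Set X) (s.ker.support : Set X) :=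
    fun I hI => disjoint_support_of_inter_fibre_eq_singleton (σ ≫ q) s.ker I hCb hI
  -- the plane model
  obtain ⟨𝓔, rfl, hEi, hEii, hEiii, hEiv, hEfe, hEcart⟩ :=
    exists_planeModel (Y := Y) hXreg hsreg hsflat hsoff hτ hyc hGreg hυ₂ hcomm hCD
  refine ⟨s, X'', τ, j₂, t₂, hs, hss₀, hτ, hsreg, hsflat, hCD, hsoff, hCb, hdisj, ?_, hreg'', hnoeth'', hint'', hdom'', hG'int, hT'irr, hGnoeth,
    hsq₂, hcomm, hcarrier, hsets, hEi, hEii, hEiii, hEiv, hEfe, hEcart⟩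
  rw [hsets]; exact hCh''

end PtRegStage

end Summit.ResolutionOfSingularities.ResolutionOfSingularities.Cruxes.EquisingularLiftNat.Sections

end
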